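import Mathlib
import HarnessLib
import HarnessLib.Audit
import Summits.QuantumFields.Statement
import Summits.QuantumFields.YangMills.Theses.UnitScaleTilt
import Summits.QuantumFields.YangMills.Theses.CovariantDischarge
import Literature.MathematicalPhysics.QuantumFieldTheory.Balaban1983to89.T3YM3TorusStatement
import Literature.MathematicalPhysics.QuantumFieldTheory.Balaban1983to89.WilsonLoopLimit
import HarnessLib.Audit.Status.Attr

/-!
Route: RectangleDomination

# Route RectangleDomination — Averaged-plaquette tails from rectangular Wilson-loop tails via
shallow non-abelian Stokes domination

LINE 17 of ideator seat ym-r3-idea-2 (g8, lens «nearmiss»; bears_on LADDER-YM rung R3 = leaf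
`T3YM3TorusStatement.YM3TorusSU2` via crux
stmt-QuantumFields-19936 `UnitScaleTilt.HistoryTailL`; no summit and no rung is proved by this
line). It suffices to show X = X₁ ∧ X₂ ∧ X₃:
X₁ (RectangleTailL, deciding) a stretched-exponential PERIMETER-LAW tail for contractible
rectangular Wilson loops of the finest lattice of
run K, uniform in the cut-off; X₂ (ShallowRectangleDominationL, deterministic) the j-fold
Bałaban-averaged plaquette is dominated LINEARLY by
rectangle holonomies carrying the natural scale profile η·√(L^i/L^j), in the shallow regime
√(L^j)(j+1)η ≤ η₀; X₃ (DeepWindowTailL) the shared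
organ-class residual of route CovariantDischarge at window ratio N₁ = 3. A union bound over ≤
poly(L^(m+K)) rectangles and the identity
θ(h)²β_K/L^j = p(g_h)² turn X₁ ∧ X₂ into the per-plaquette tails of the levels j ≤ K/3; X₃ covers K
< 3j; the first-exit bookkeeping gives HistoryTailL,
and the parent's `UnitScaleTilt.closes` with the two untouched RegPr residuals reaches the rung.
Lean: `RectangleTailL ∧ ShallowRectangleDominationL ∧ DeepWindowTailL`

## Assembly
Pure logic on top of the parent route: `UnitScaleTilt.closes h200 h201 (hGlue hRect hDom hDeep)` —
the glue item turns the three tail cruxes into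
`UnitScaleTilt.HistoryTailL`, and the parent's deciding theorem with the two untouched RegPr
residuals gives the rung leaf (not the summit Statement).

CLOSES_TARGET: closes rung R3 of QuantumFields: Literature.MathematicalPhysics.QuantumFieldTheory.Balaban1983to89.T3YM3TorusStatement.YM3TorusSU2 (D-0061; not the summit Statement) — the deciding theorem of this route concludes that registered leaf instead of the Statement decl `YangMills` (class rung: servable and labelled, never counted as concluding the summit Statement).

Rationale: WHY THIS LINE. Near-miss harvested: the tree's bounded-depth theorem
`HistoryTailBoundedHeightLocal.perPlaquette_boundedHeight_uniform` proves the per-plaquette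
schema with the MEASURED deficit c = ¼Λ^(−2j₀) (Λ = 151L²) because its footprint consists of fine
PLAQUETTES (area scaling: thresholds shrink by Λ per
level); the single input changed here is the footprint — fine RECTANGLES, whose thresholds shrink
only by √L per level (perimeter scaling). New object on this crux: UNSMEARED rectangular Wilson
loops W(x; μ,ν; a,b) of the finest lattice (tree `Missing.rectLoop`, `Missing.pathHol`) —
none of the sixteen listed lines or the owner's skeletons leaves Bałaban's averaged plaquettes.
Mechanism: unrolling `BlockAveraging.avgFun =
corr · axialAvg` ([Balaban1987RG1] (0.4)) j times writes Ū^j(∂q) as the finest holonomy of the big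
square ∂q with correction factors
inserted along its sides; to first order the corrections TELESCOPE along each side
(translation-covariant symmetric constituent weights) into
O(j) averaged thin-strip and corner loops, all products of ≤ 64 conjugated rectangles (bubble-sort
non-abelian Stokes), and the second-order
BCH area term is bounded by (Σ|X|)·max|partial strip| ≈ j^(3/2)η²√(L^j) — harmless exactly in the
shallow window. The probabilistic input is
then a classical statement about ONE gauge-invariant mesoscopic loop (perimeter law with the UV
logarithm, [ChatterjeeYMProb2019] §4,
[BrydgesFrohlichSeiler1979]; abelian sibling decided by the spin-wave computation,
arXiv:2107.04021), demanded only with SOME stretched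
exponent α > 0 because the profile p(g) = b₀(1+log g⁻¹)^(p₀) lets the glue raise p₀ ≥ 3 + 1/α.
Imported area: lattice gauge theory of
Wilson loops / non-abelian Stokes; nothing from the negatives index (no d = 3 loop-tail statement
there) is touched.

RANKED CRUXES. #2 RectangleTailL (crux) — For every L there are α, c > 0, C, A with: for every
T3Family F (F.L = L), 0 < γ ≤ 1, every run K, every contractible lattice rectangle (corner x,
directions μ ≠ ν, sides a, b ≥ 1, 2(a+b) < sites per direction) and 0 < t ≤ 1: Gibbs_K(t ≤ dist1(hol
∂rect)) ≤ C·β_K^A·(a+b)^A·exp(−(c·t²β_K/((a+b)(1+log(a+b))))^α) — a perimeter-law moderate-deviation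
bound with any stretched exponent. [difficulty: XL] (why it might fail: Uniform-in-β moderate
deviations of a mesoscopic SU(2) Wilson loop (perimeter up to o(β)) are not in print; the loop's
self-energy carries the UV log and bulk cubic interactions, so even a stretched exponent needs
line-source cluster-expansion control.) [ChatterjeeYMProb2019, BrydgesFrohlichSeiler1979,
arXiv:2107.04021, arXiv:1602.01222]
#3 ShallowRectangleDominationL (crux) — For every L there are C, R ≥ 2, η₀ > 0 with: for every F
(F.L = L), K, j ≤ K, level-j plaquette q, finest configuration U and η > 0 with √(L^j)(j+1)η ≤ η₀:
if every contractible rectangle with a+b ≤ R·L^i (i ≤ j) has dist1(hol) ≤ η√(L^i/L^j), then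
dist1(Ū^j(∂q)) ≤ C(j+1)η (deterministic, via unrolled avgFun = corr·axialAvg, first-order
telescoping along the sides, bubble-sort non-abelian Stokes into ≤ 64 rectangles per polygon, BCH
second order absorbed by the side condition). [difficulty: L] (why it might fail: The BCH area term
of ~4L^(j−i) correction insertions per side is bounded deterministically only by j^(3/2)η²√(L^j)
(spiral worst case), hence the side condition; if the EML chart guard `Small` flips inside a side
the telescoping acquires extra boundary terms.) [Balaban1987RG1, Balaban1985Averaging,
ChatterjeeYMProb2019]
#4 DeepWindowTailL (crux) — RESIDUAL (organ-class; byte-identical with route CovariantDischarge item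
stmt-QuantumFields-22892): for every L and every N₁ > 0 the window schema (finer levels θ(b₀)-small
∧ level j θ(b₂)-small ∧ θ(b₀)(K−j) ≤ dist1(Ū^j(∂p))) has Gaussian-profile Gibbs mass at the deep
levels K < N₁·j; used here at N₁ = 3 only. [difficulty: open-problem] (why it might fail: At depth j
≥ K/2 a tower of marginally-large finer levels shifts Ū^j by ≳ r·θ and bare fibre convexity is
measured dead (JOB B); Gaussian strength there is exactly Bałaban's unprinted large-field
induction.) [Balaban1989LargeFieldII, Balaban1988Convergent, Balaban1985UV3]
#5 FluctuationComparisonRegPrIntL (crux) — Parent residual of route UnitScaleTilt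
(stmt-QuantumFields-20520, byte-identical): regulated-pressure fluctuation comparison; untouched by
this line. [difficulty: open-problem] (why it might fail: It is Bałaban's small-field
effective-action comparison between runs K and K+1 with K-uniform constants — printed only inside
the inductive renormalization scheme, never as a stand-alone pressure statement.) [Balaban1985UV3,
Balaban1988Convergent]
#6 MinimiserStabilityRegPr (crux) — Parent residual of route UnitScaleTilt
(stmt-QuantumFields-19200, byte-identical): stability of the regulated-pressure minimiser; untouched
by this line. [difficulty: open-problem] (why it might fail: Uniform positivity of the background
Hessian along the whole trajectory is Bałaban's variational-problem analysis; a degenerate toron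
direction on the 3-torus could violate the stated uniform constant.) [Balaban1985UV3,
Balaban1987RG1]
#9 HistoryTailOfRectanglesL (support) — Glue: RectangleTailL → ShallowRectangleDominationL →
DeepWindowTailL → UnitScaleTilt.HistoryTailL. Given L take (α,c,C,A) and (C₃,R,η₀); choose b₀ =
max(b₁,1), p₀ ≥ max(p₁, 3 + 1/α); for m take N₁ = 3 in the residual and γ₁(m) small. Shallow levels
j ≤ K/3 (so j ≤ h/2, h = K−j): with η = θ(h)/(2C₃(j+1)) the side condition reads
√γ·L^((j−h)/2)(j+1)p(g_h) ≤ 2C₃η₀, true for γ ≤ γ₁; contrapositive of X₂ + union over ≤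
(j+1)·#sites·9·(RL^j)² rectangles + X₁ at t = η√(L^i/L^j), whose exponent is
(c·p(g_h)²/(4C₃²R(j+1)²(1+log R+i log L)))^α since θ(h)²β_K/L^j = p(g_h)²; deep levels from X₃; sum
over plaquettes and heights (prefactor exp(O(m h log L)) on the wedge K ≤ m(h+1)) is summable
because α(2p₀−4) > 1; first-exit decomposition of histGoodᶜ (tree real_compl_histGood_le_sum) for
runs K and K+1. [difficulty: M] [Balaban1985UV3, King1986]

TWO-LAYER PLAN. RectangleTailL ⇐ (sub-Gaussian moments of the rectangle holonomy, ∫ dist1^n ≤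
Cβ^A(a+b)^A(C n (a+b)(1+log(a+b))/β)^(n/2)) → (Markov optimisation) → RectangleTailL.
ShallowRectangleDominationL ⇐ (chart guards `BlockAveraging.Small` hold at all levels i < j under
the hypotheses) → (telescoped two-term bound C(j+1)η + C(j+1)²η²√(L^j) without side condition) →
crux.

KILL CRITERIA. Refutation of RectangleTailL (a contractible rectangle family whose tail at t ≍
√(perimeter·log/β)·p is heavier than every stretched exponential
uniformly in β) closes the route (close --reason refuted:RectangleTailL). Refutation of
ShallowRectangleDominationL by an explicit configuration with
all profile-flat rectangles but dist1(Ū^j(∂q)) > C(j+1)η inside the side condition forces a pivot to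
a smaller window (side condition L^j(j+1)η ≤ η₀,
window j ≤ K/4). DeepWindowTailL refuted ⇒ shared fate with CovariantDischarge (pivot to the
HistoryWedge depth cap). HistoryTailL proved elsewhere moots the line.

NOT DECOMPOSED YET. The exact finite menu of polygons produced by unrolling avgFun (strips per
offset u, corner loops per contour Γ), the constant 64 of the bubble-sort
Stokes reduction, the β-prefactor exponents A, and the first-exit bookkeeping constants of the glue
— all layer-2.

CHEAPEST FALSIFIER. Instrument row L17-A (for idea-crit-5 / engines; kit not held by this seat):
femto lattices L ∈ {2,3}, K ≤ 6, j ∈ {1,2,3}: on Gibbs samples AND on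
adversarial smooth configurations (constant-curvature and sign-alternating abelian backgrounds,
spiral su(2) profiles) compute
ρ = dist1(Ū^j(∂q)) / ((j+1)·max_i max_rect dist1(hol rect)/√(L^i/L^j)); KILL
ShallowRectangleDominationL if ρ grows like a power of L^j inside
√(L^j)(j+1)η ≤ 0.1. Row L17-B: histogram of dist1(hol ∂rect)/√((a+b)(1+log(a+b))/β_K) for a+b ∈
{4,8,16,32} at three β; KILL RectangleTailL if
the fitted tail exponent α̂ → 0 with a+b or the curves do not collapse in the perimeter variable.

NUMBERS. Perimeter-law variance of the rectangle angle at one loop: σ² ≈ c·g_K²·(a+b)·log(a+b)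
(Coulomb self-energy of a thin current loop in d = 3);
θ(h)²·β_K/L^j = p(g_h)² exactly (θ(i) = g_i p(g_i), g_i² = γL^(−i), β_K = L^K/γ); window split at N₁
= 3 (j ≤ K/3 ⇔ j ≤ h/2).

DEFINITION REQUESTS. None: `Missing.rectLoop`, `Missing.pathHol`, `GaugeGroup.dist1`,
`BlockAveraging.blockAvg`, `T3UnitScaleTilt.gibbsK` exist.

Novelty: Searches (2026-08-28): lit search --hybrid "moderate deviations Wilson loop weak coupling lattice
gauge perimeter fluctuations" (8 hits, textbooks only:
[corpus:creutz2022 p.103], [corpus:montvay1994 p.163], [corpus:greensite2011 p.18]); lit vsearch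
"sub-Gaussian concentration of Wilson loop holonomy at weak coupling" (no rigorous hit);
lit galaxy search "Wilson loop|perimeter law" --star pdf (6 hits, none on moderate deviations:
[galaxy:pdf:5716515539505956260] multiparton webs, [galaxy:pdf:2491790078706757120]);
ledger negatives --problem QuantumFields (no loop-tail statement); the sixteen route files of this
crux (none uses unsmeared loops).
Nearest prior art found: arXiv:2107.04021 (Garban–Sepúlveda, U(1): Wilson loop = Gaussian spin wave
× vortex correction — the abelian sibling of RectangleTailL); arXiv:1602.01222 (Chatterjee, leading
term of the free energy, no loop tails); BrydgesFrohlichSeiler1979 (cluster expansion for loop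
expectations at strong/intermediate coupling); nearest listed route:
route-QuantumFields-PoincareLipschitz (link-Lipschitz × block locality on averaged plaquettes).
Delta: replaces the averaged plaquette by finest-lattice rectangular Wilson loops through a
deterministic shallow non-abelian Stokes domination with the natural √(L^i/L^j) scale profile, so
the probabilistic crux becomes a perimeter-law tail of one classical gauge-invariant loop with any
stretched exponent.
Claimed grade: new-mechanism  [refs: 2107.04021, 1602.01222, BrydgesFrohlichSeiler1979]

Barriers (technique_class: wilson-loop-tail, nonabelian-stokes, union-bound): - technique_class: wilson-loop-tail, nonabelian-stokes, union-bound
- Literature.Barriers.QuantumFields.PerturbativeInvisibility: it does not evade it fully; the bet is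
that the rectangle tail is a UV/perimeter quantity visible to Gaussian-class expansions (σ² = c
g²(a+b)log(a+b)), not an infrared one — confinement enters only at perimeters ≳ β_K, where the bound
is void anyway.
- Literature.Barriers.QuantumFields.ElitzurTheorem: evaded — every object (rectangle holonomy, dist1
of Ū^j(∂q)) is gauge invariant; no link expectation is used.
- Literature.Barriers.QuantumFields.ToronPlaneAnticorrelation: evaded — no correlation inequality;
torons shift a contractible rectangle's angle by ≤ 2π·ab/N² ≤ 2πL^(−2(m+h)), invisible at every
height.
- Literature.Barriers.QuantumFields.UVStabilityNonUniqueness: not engaged — no effective action or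
minimiser is constructed; the residual X₃ carries the organ-class part explicitly.
- Negatives index: stmt 26948/26997 (uniform sup level-shift), 28261 (SandwichMoments), 18944, 16181
— none is a loop-tail or a deterministic domination statement; the line asserts no sup-density or
level-shift bound.

sub-problem: YangMills · status: draft · opened planner-ym-r3-idea-2-g8-0 2026-08-29T00:30:46Z · rev 0 · ledger route-QuantumFields-RectangleDomination
GENERATED by the gate from the ledger (D-0016/17). Provers cite these decls: `theorem foo : Summit.QuantumFields.YangMills.Theses.RectangleDomination.<Decl> := …` in Summits/QuantumFields/YangMills/Theorems/<Name>.lean.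
-/

namespace Summit.QuantumFields.YangMills.Theses.RectangleDomination

open scoped BigOperators Topology Manifold Classical MeasureTheory ProbabilityTheory Matrix InnerProductSpace ComplexConjugate ContinuousMap
open Filter Set Function TopologicalSpace MeasureTheory

attribute [summit_statement] _root_.YangMills
attribute [summit_statement] _root_.Literature.MathematicalPhysics.QuantumFieldTheory.Balaban1983to89.T3YM3TorusStatement.YM3TorusSU2

/-- item stmt-QuantumFields-23864 · crux · rank 2 · open · by planner
why it might fail: Uniform-in-β moderate deviations of a mesoscopic SU(2) Wilson loop (perimeter up to o(β)) are not in print; the loop's self-energy carries the UV log and bulk cubic interactions, so even a stretched exponent needs line-source cluster-expansion control.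
sources: ChatterjeeYMProb2019, BrydgesFrohlichSeiler1979, arXiv:2107.04021, arXiv:1602.01222
[crux] For every L there are α, c > 0, C, A with: for every T3Family F (F.L = L), 0 < γ ≤ 1, every
run K, every contractible lattice rectangle (corner x, directions μ ≠ ν, sides a, b ≥ 1, 2(a+b) <
sites per direction) and 0 < t ≤ 1: Gibbs_K(t ≤ dist1(hol ∂rect)) ≤
C·β_K^A·(a+b)^A·exp(−(c·t²β_K/((a+b)(1+log(a+b))))^α) — a perimeter-law moderate-deviation bound
with any stretched exponent. [difficulty: XL] -/
@[route_item "route-QuantumFields-RectangleDomination", crux]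
def RectangleTailL : Prop :=
  open Literature.MathematicalPhysics.QuantumFieldTheory.Balaban1983to89 Literature.MathematicalPhysics.QuantumFieldTheory.Balaban1983to89.T3ContinuumYM3Torus in ∀ (L : ℕ), ∃ (α c C : ℝ) (A : ℕ), 0 < α ∧ 0 < c ∧ 0 ≤ C ∧ ∀ (F : T3Family) (γ : ℝ), F.L = L → 0 < γ → γ ≤ 1 → ∀ (K a b : ℕ) (x : Site (F.P K) 0) (μ ν : Fin (F.P K).d) (t : ℝ), μ ≠ ν → 1 ≤ a → 1 ≤ b → 2 * (a + b) < (F.P K).sitesPerDir 0 → 0 < t → t ≤ 1 → (T3UnitScaleTilt.gibbsK F T3UnitLawDensityEML.ℰp γ K).real {U | t ≤ GaugeGroup.dist1 (Missing.pathHol U (Missing.rectLoop x μ ν a b))} ≤ C * (F.scheme T3UnitLawDensityEML.ℰp γ).β K ^ A * ((a : ℝ) + b) ^ A * Real.exp (-((c * (t ^ 2 * (F.scheme T3UnitLawDensityEML.ℰp γ).β K / (((a : ℝ) + b) * (1 + Real.log ((a : ℝ) + b))))) ^ α))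

/-- item stmt-QuantumFields-23865 · crux · rank 3 · open · by planner
why it might fail: The BCH area term of ~4L^(j−i) correction insertions per side is bounded deterministically only by j^(3/2)η²√(L^j) (spiral worst case), hence the side condition; if the EML chart guard `Small` flips inside a side the telescoping acquires extra boundary terms.
sources: Balaban1987RG1, Balaban1985Averaging, ChatterjeeYMProb2019
[crux] For every L there are C, R ≥ 2, η₀ > 0 with: for every F (F.L = L), K, j ≤ K, level-j
plaquette q, finest configuration U and η > 0 with √(L^j)(j+1)η ≤ η₀: if every contractible
rectangle with a+b ≤ R·L^i (i ≤ j) has dist1(hol) ≤ η√(L^i/L^j), then dist1(Ū^j(∂q)) ≤ C(j+1)η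
(deterministic, via unrolled avgFun = corr·axialAvg, first-order telescoping along the sides,
bubble-sort non-abelian Stokes into ≤ 64 rectangles per polygon, BCH second order absorbed by the
side condition). [difficulty: L] -/
@[route_item "route-QuantumFields-RectangleDomination", crux]
def ShallowRectangleDominationL : Prop :=
  open Literature.MathematicalPhysics.QuantumFieldTheory.Balaban1983to89 Literature.MathematicalPhysics.QuantumFieldTheory.Balaban1983to89.T3ContinuumYM3Torus in ∀ (L : ℕ), ∃ (C R η₀ : ℝ), 0 < C ∧ 2 ≤ R ∧ 0 < η₀ ∧ ∀ (F : T3Family), F.L = L → ∀ (K j : ℕ) (q : Plaq (F.P K) j) (U : GaugeField (F.P K) 0 (Matrix.specialUnitaryGroup (Fin 2) ℂ)) (η : ℝ), j ≤ K → 0 < η → Real.sqrt ((L : ℝ) ^ j) * (j + 1) * η ≤ η₀ → (∀ (i a b : ℕ) (x : Site (F.P K) 0) (μ ν : Fin (F.P K).d), μ ≠ ν → i ≤ j → 1 ≤ a → 1 ≤ b → 2 * (a + b) < (F.P K).sitesPerDir 0 → ((a : ℝ) + b) ≤ R * (L : ℝ) ^ i → GaugeGroup.dist1 (Missing.pathHol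 U (Missing.rectLoop x μ ν a b)) ≤ η * Real.sqrt ((L : ℝ) ^ i / (L : ℝ) ^ j)) → GaugeGroup.dist1 (GaugeField.plaqHol (Averaging.iter (fun i => BlockAveraging.blockAvg (P := F.P K) (j := i) T3UnitLawDensityEML.ℰp) j U) q) ≤ C * (j + 1) * η

/-- item stmt-QuantumFields-22892 · crux · rank 4 · open · by planner
why it might fail: At depth j ≥ K/2 a tower of marginally-large finer levels shifts Ū^j by ≳ r·θ and bare fibre convexity is measured dead (JOB B); Gaussian strength there is exactly Bałaban's unprinted large-field induction.
sources: Balaban1989LargeFieldII, Balaban1988Convergent, Balaban1985UV3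
[crux] RESIDUAL (organ-class; implied verbatim by stmt-26243): for every L and every N₁ > 0, the
same window schema for the DEEP levels 1 ≤ j ≤ K with K < N₁·j (constants may depend on N₁).
[difficulty: open-problem] -/
@[route_item "route-QuantumFields-RectangleDomination", crux]
def DeepWindowTailL : Prop :=
  open Literature.MathematicalPhysics.QuantumFieldTheory.Balaban1983to89 Literature.MathematicalPhysics.QuantumFieldTheory.Balaban1983to89.T3ContinuumYM3Torus in ∀ (L N₁ : ℕ), 0 < N₁ → ∀ (b₀ p₀ b₂ : ℝ), 0 < b₀ → 2 < p₀ → b₀ ≤ b₂ → ∃ (γ₁ C c : ℝ) (N : ℕ), 0 < γ₁ ∧ γ₁ ≤ 1 ∧ 0 < c ∧ ∀ (F : T3Family) (γ : ℝ), F.L = L → 0 < γ → γ ≤ γ₁ → ∀ (K j : ℕ), 1 ≤ j → j ≤ K → K < N₁ * j → ∀ p : Plaq (F.P K) j, (T3UnitScaleTilt.gibbsK F T3UnitLawDensityEML.ℰp γ K).real {U | (∀ k, k < j → PlaqSmall (T3UnitScaleTilt.θBal F.L γ b₀ p₀ (K - k)) (Averaging.iter (fun i => BlockAveraging.blockAvg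 (P := F.P K) (j := i) T3UnitLawDensityEML.ℰp) k U)) ∧ PlaqSmall (T3UnitScaleTilt.θBal F.L γ b₂ p₀ (K - j)) (Averaging.iter (fun i => BlockAveraging.blockAvg (P := F.P K) (j := i) T3UnitLawDensityEML.ℰp) j U) ∧ T3UnitScaleTilt.θBal F.L γ b₀ p₀ (K - j) ≤ GaugeGroup.dist1 (GaugeField.plaqHol (Averaging.iter (fun i => BlockAveraging.blockAvg (P := F.P K) (j := i) T3UnitLawDensityEML.ℰp) j U) p)} ≤ C * ((γ * ((F.L : ℝ)⁻¹) ^ (K - j))⁻¹) ^ N * Real.exp (-(c * B10.pFun b₀ p₀ (Real.sqrt (γ * ((F.L : ℝ)⁻¹) ^ (K - j))) ^ 2))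

/-- item stmt-QuantumFields-20520 · crux · rank 5 · open · by operator
why it might fail: It is Bałaban's small-field effective-action comparison between runs K and K+1 with K-uniform constants — printed only inside the inductive renormalization scheme, never as a stand-alone pressure statement.
sources: Balaban1985UV3, Balaban1988Convergent
[crux] K1b-INT (E-INT interior excision of FluctuationComparisonRegPrL, OWNER RULING g22-№3 §B +
ADDENDUM 1; card C8 `edge-band-to-the-tail`): for every L there are an EXCISION RATIO 0 < c ≤ 1 and
THRESHOLDS (b₁, p₁) such that for every profile (b₀, p₀) with b₁ ≤ b₀, p₁ ≤ p₀, 0 < b₀, 2 < p₀ there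
is ε₁ > 0 such that for every 0 < ε₀ ≤ ε₁ there is m₀ such that for every m ≥ m₀ there is a
volume-uniform γ₁ > 0 such that for every T3Family F with F.L = L and 0 < γ ≤ γ₁,
`T3InteriorExcision.FluctuationComparisonRegPrIntAt F γ b₀ p₀ m c ε₀`: a.e. on the SHRUNK window
`PlaqSmall (θBal L γ (c·b₀) p₀ (K/m))` both restricted height densities of runs K and K+1 on the
histGood events at the ORIGINAL profile (b₀, p₀) are positive and log ρ + β·minActionRegPr of the
two runs agree modulo constants κ_K up to summable r_K (same body as FluctuationComparisonRegPrAt;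
only the a.e. guard is the c-window). FORMALLY WEAKER than FluctuationComparisonRegPrL (c = 1;
window monotone in b₀: `θBal_mono_b`), NO edge clause (the band {θ(c·b₀)-large, θ(b₀)-small} is
charged to HistoryTailL, whose profile floor absorbs the rescaling:
`T3InteriorExcision.unitTiltTail_of_interior`), and on the c-window print's χ -/
@[route_item "route-QuantumFields-RectangleDomination", crux]
def FluctuationComparisonRegPrIntL : Prop :=
  open Literature.MathematicalPhysics.QuantumFieldTheory.Balaban1983to89 Literature.MathematicalPhysics.QuantumFieldTheory.Balaban1983to89.T3ContinuumYM3Torus in ∀ (L : ℕ), ∃ (c b₁ p₁ : ℝ), 0 < c ∧ c ≤ 1 ∧ ∀ (b₀ p₀ : ℝ), b₁ ≤ b₀ → p₁ ≤ p₀ → 0 < b₀ → 2 < p₀ → ∃ ε₁ : ℝ, 0 < ε₁ ∧ ∀ (ε₀ : ℝ), 0 < ε₀ → ε₀ ≤ ε₁ → ∃ m₀ : ℕ, ∀ (m : ℕ), m₀ ≤ m → ∃ γ₁ : ℝ, 0 < γ₁ ∧ ∀ (F : T3Family) (γ : ℝ), F.L = L → 0 < γ → γ ≤ γ₁ → T3InteriorExcision.FluctuationComparisonRegPrIntAt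 F γ b₀ p₀ m c ε₀

/-- item stmt-QuantumFields-19200 · crux · rank 6 · open · by operator
why it might fail: Uniform positivity of the background Hessian along the whole trajectory is Bałaban's variational-problem analysis; a degenerate toron direction on the 3-torus could violate the stated uniform constant.
sources: Balaban1985UV3, Balaban1987RG1
[crux] K1aR-pr (E-min at the minimum over PRINT'S regular space (6) of Balaban1985Variational IN
FULL — both clauses of (2): small plaquette variables AND small covariant divergence
Balaban1985RegularSpaces (1.9); replaces MinimiserStability stmt-QuantumFields-19822; supersedes
children-v2's plaquette-only MinimiserStabilityReg, which needed the unprinted gap G-K1aR-1 on top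
of [7] Thm 1) — for every block size L there is ε₁(L) > 0 (the uniqueness radius a₀ of
Balaban1985Variational Thm 1, «depends on d and L only») such that for every 0 < ε₀ ≤ ε₁, all
sufficiently large m ≥ m₀(L, ε₀), every profile (b₀, p₀) and all 0 < γ ≤ γ₁(L, ε₀, m, b₀, p₀), every
T3Family F with F.L = L: `MinimiserStabilityRegPrAt F γ b₀ p₀ m ε₀` (tree module
`T3PrintedRegularMinimiser` = `BgStabilityAt` at the printed backgrounds `bgRegPr`/`bgRegPr'`) —
summable r_K ≥ 0 and constants κ_K with, for every K and EVERY θBal(⌊K/m⌋)-small field V on the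
comparison lattice, |β_{K+1}·minActionRegPr_{K+1}(V) − β_K·minActionRegPr_K(V) − κ_K| ≤ r_K (κ
idle), where minActionRegPr_K(V) = inf of the Wilson action over run K's fibre of V ∩ {|U(∂p) − 1| <
ε₀L^{-2(K−⌊K/m⌋)} ∀p} ∩ {‖(D^{1*}_U ∂U)(b)‖ < ε₀L^{-3(K−⌊K/m⌋)} ∀b} (d -/
@[route_item "route-QuantumFields-RectangleDomination", crux]
def MinimiserStabilityRegPr : Prop :=
  open Literature.MathematicalPhysics.QuantumFieldTheory.Balaban1983to89 Literature.MathematicalPhysics.QuantumFieldTheory.Balaban1983to89.T3ContinuumYM3Torus in ∀ (L : ℕ), ∃ ε₁ : ℝ, 0 < ε₁ ∧ ∀ (ε₀ : ℝ), 0 < ε₀ → ε₀ ≤ ε₁ → ∃ m₀ : ℕ, ∀ (m : ℕ), m₀ ≤ m → ∀ (b₀ p₀ : ℝ), 0 < b₀ → 2 < p₀ → ∃ γ₁ : ℝ, 0 < γ₁ ∧ ∀ (F : T3Family) (γ : ℝ), F.L = L → 0 < γ → γ ≤ γ₁ → T3PrintedRegularMinimiser.MinimiserStabilityRegPrAt F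 γ b₀ p₀ m ε₀

/-- item stmt-QuantumFields-23867 · support · rank 9 · closed · proved by Summit.QuantumFields.YangMills.Theorems.rectangleDomination_historyTailOfRectanglesL_proof (prover) · by planner
sources: Balaban1985UV3, King1986
[support] Glue: RectangleTailL → ShallowRectangleDominationL → DeepWindowTailL →
UnitScaleTilt.HistoryTailL. Given L take (α,c,C,A) and (C₃,R,η₀); choose b₀ = max(b₁,1), p₀ ≥
max(p₁, 3 + 1/α); for m take N₁ = 3 in the residual and γ₁(m) small. Shallow levels j ≤ K/3 (so j ≤
h/2, h = K−j): with η = θ(h)/(2C₃(j+1)) the side condition reads √γ·L^((j−h)/2)(j+1)p(g_h) ≤ 2C₃η₀,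
true for γ ≤ γ₁; contrapositive of X₂ + union over ≤ (j+1)·#sites·9·(RL^j)² rectangles + X₁ at t =
η√(L^i/L^j), whose exponent is (c·p(g_h)²/(4C₃²R(j+1)²(1+log R+i log L)))^α since θ(h)²β_K/L^j =
p(g_h)²; deep levels from X₃; sum over plaquettes and heights (prefactor exp(O(m h log L)) on the
wedge K ≤ m(h+1)) is summable because α(2p₀−4) > 1; first-exit decomposition of histGoodᶜ (tree
real_compl_histGood_le_sum) for runs K and K+1. [difficulty: M] -/
@[route_item "route-QuantumFields-RectangleDomination", crux]
def HistoryTailOfRectanglesL : Prop :=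
  RectangleTailL → ShallowRectangleDominationL → DeepWindowTailL → Summit.QuantumFields.YangMills.Theses.UnitScaleTilt.HistoryTailL

-- `HistoryTailOfRectanglesL` holds: proved by `Summit.QuantumFields.YangMills.Theorems.rectangleDomination_historyTailOfRectanglesL_proof` (its module imports this route file, so no `_holds` link can be stated here).

/-- item stmt-QuantumFields-23868 · assembly · rank 1 · closed · proved by Summit.QuantumFields.YangMills.Theorems.rectangleDomination_assembly_proof (prover) · by planner
sources: Balaban1985UV3, King1986
[assembly] MinimiserStabilityRegPr → FluctuationComparisonRegPrIntL → RectangleTailL →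
ShallowRectangleDominationL → DeepWindowTailL → HistoryTailOfRectanglesL → YM3TorusSU2 (rung R3). -/
@[route_item "route-QuantumFields-RectangleDomination"]
def Assembly : Prop :=
  MinimiserStabilityRegPr → FluctuationComparisonRegPrIntL → RectangleTailL → ShallowRectangleDominationL → DeepWindowTailL → HistoryTailOfRectanglesL → Literature.MathematicalPhysics.QuantumFieldTheory.Balaban1983to89.T3YM3TorusStatement.YM3TorusSU2

-- `Assembly` holds: proved by `Summit.QuantumFields.YangMills.Theorems.rectangleDomination_assembly_proof` (its module imports this route file, so no `_holds` link can be stated here).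

/-! D-0027 §2.1 — DECIDING THEOREM (planner-authored via `route open/edit --closes-file`; by planner-ym-r3-idea-2-g8-0 2026-08-29T00:30:46Z):
its hypotheses are this route's items and its conclusion the registered leaf `Literature.MathematicalPhysics.QuantumFieldTheory.Balaban1983to89.T3YM3TorusStatement.YM3TorusSU2` (rung R3, D-0061) (glue_lint), and it elaborates with this file. -/

@[closes "route-QuantumFields-RectangleDomination"] theorem closes (h200 : MinimiserStabilityRegPr) (h201 : FluctuationComparisonRegPrIntL) (hR : RectangleTailL)
    (hD : ShallowRectangleDominationL) (hW : DeepWindowTailL) (hG : HistoryTailOfRectanglesL) :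
    Literature.MathematicalPhysics.QuantumFieldTheory.Balaban1983to89.T3YM3TorusStatement.YM3TorusSU2 :=
  Summit.QuantumFields.YangMills.Theses.UnitScaleTilt.closes h200 h201 (hG hR hD hW)

end Summit.QuantumFields.YangMills.Theses.RectangleDomination
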